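import Mathlib.AlgebraicGeometry.EllipticCurve.VariableChange
import Mathlib.NumberTheory.Zsqrtd.QuadraticReciprocity
import Summits.Ventures.AbcSig.Levels.N10016

/-!
# Venture AbcSig — the ℚ-curve of record behind orbit `10016.1` (level `10016 = 2⁵·313`), as a kernel object

HONEST FRAMING. This file records, as a Mathlib `WeierstrassCurve` over the Gaussian integers `ℤ[i]` (`GaussianInt`), the
elliptic curve
  `E : y² = x³ + (−132 + 132i)·x² + (3419 − 4356i)·x`
that the computation cell `pub-abcsig` IDENTIFIED (identification grade — matching invariants and point counts, NO
Faltings–Serre proof) on three independent code paths as the curve over `ℚ(i)` behind the newform orbit `10016.1`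
(degree 2 over `ℚ(√2)`, inner twist by `χ₋₄`) — the orbit carrying the cell's one OPEN INSTANCE `(ℓ; n) = (313; 23)` of
erratum E-LR32-313 (`Conjectures/LevelRaising32L2.lean`, module docstring). Records: HOME/engine/engine-2/results/L313-QCURVE-g31/
L313-QCURVE-g31.md 07aeccfc7a6a1711 (first hand), HOME/engine/engine1-0.5/notes-g22/qcurve/QCURVE-10016-e1g22.md 02ae753dc6228d0b →
0fd63b439a093a0f (blind second hand, CONCUR), HOME/bench/rows/XREAD-L313-QCURVE-THIRD-g30/README.md 972b891f208951a1 (third, SAME OBJECT),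
print side HOME/lit/Qcurve-conductor-identities-asprinted-lit-g28.md 173f86e6b6d86d4e; booked HOME/STRUCTURE.md v3.22 §6 (17) / §8b (au).

WHAT IS KERNEL-CHECKED HERE (exact arithmetic in `ℤ[i]`, `ZMod 313` and on integer pairs; nothing else):
* the invariants of THIS MODEL by Mathlib's own formulas: `c₄`, `c₆`, `Δ(E) = i·(1+i)¹²·π³·π̄⁶` with `π = 12 + 13i`,
  `N(π) = 313`, `π` a Gaussian prime (proved), `a₄ = i·π̄³`, `N(Δ) = 2¹²·313⁹`;
* local data at the two primes above `313` through the explicit reduction maps `ℤ[i] → 𝔽₃₁₃` (`i ↦ 288` kills `π`, `i ↦ 25`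
  kills `π̄`): `π ∤ c₄`, `π̄ ∤ c₄`, `v_π(Δ) = 3`, `v_π̄(Δ) = 6` (as `Δ = π³·D₁ = π̄⁶·D₂` with `D₁ ≢ 0 (mod π)`, `D₂ ≢ 0 (mod π̄)`), the reduced
  cubics `x(x − 151)²` resp. `x²(x + 38)` and the squares `151 = 82²`, `38 = 59²` in `𝔽₃₁₃` — i.e. the data from which the
  standard theory (Tate's algorithm, [Sil09, VII.5.1 (b), C.15]; NOT re-proved here) reads: multiplicative reduction of types
  `I₃` at `π` and `I₆` at `π̄`, both SPLIT, model minimal at `π`, `π̄`. NO claim is made at the prime `(1 + i)` (the hands' own Tate runs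
  give `I₂*`, `f = 6`; Tate's algorithm is not in the kernel) and NO conductor is asserted;
* the coefficient identity behind "`E` is a ℚ-curve of degree 2": the codomain of the 2-isogeny with kernel `⟨(0, 0)⟩`, in the
  PRINTED normal form `y² = x³ − 2a₂·x² + (a₂² − 4a₄)·x` ([ST92, III §4, Prop. on p. 79]; [Sil09, III.4.5] — the isogeny itself is
  CITED, not constructed here), has coefficients `((1+i)²·ā₂, (1+i)⁴·ā₄)`, i.e. it is the `(1+i)`-rescaling of the Galois
  conjugate model `E^σ`; the general lemma `intScale_eq_smul` identifies that rescaling with Mathlib's `VariableChange` wherever `1 + i`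
  is invertible (so over `ℚ(i)`, or any field of characteristic `≠ 2` receiving `ℤ[i]`, the printed codomain is isomorphic to `E^σ`);
* two ties to the level file of record `Levels/N10016.lean`, whose `cp_10016_1` lists `P₇ = P₂₃ = t² − 18` for `10016.1`
  (`c₇² = c₂₃² = 18`): by transparent double enumeration over `𝔽_q[i] = 𝔽_{q²}` (`q ≡ 3 (mod 4)` inert),
  `#E(𝔽₄₉) = 46 = (7 + 1)² − 18` and `#E(𝔽₅₂₉) = 558 = (23 + 1)² − 18` — the values the identification predicts at an inert prime
  (`a_{(q)}(E) = c_q² − 2q`, so `#E(𝔽_{q²}) = (q + 1)² − c_q²`).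
WHAT IS NOT CLAIMED: that `E` is modular of level `10016`, that its `L`-function is that of `10016.1`, its conductor, anything
about the open instance `Q(313; 23)`, about ABC or any summit. Identities of the DERIVED model only: «`10016.1 ↔ E`» is the cell's
identification-grade HYPOTHESIS (three hands 07aeccfc7a6a1711 / 02ae753dc6228d0b / 972b891f208951a1 + print side lit g28
173f86e6b6d86d4e), NOT proved here and NOT used as a hypothesis of any theorem in this file; the two «ties» below are CONSISTENCY
identities with the level file, not modularity statements. The hypothesis is used by the cell's NEXT-GRANT item «decide Q(313; 23)»
(HOME/HANDOFF.md 'STATE AT LEAD g18 CLOSE'); this file is that item's kernel anchor (lead g19 word «QCURVE-10016-LEAN», HOME/INBOX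
2026-08-27T07:16:40Z, conditions (a)–(d); booked as an ADJACENT KERNEL OBJECT, not a slice of `CONJ_LR32_L2`).

References: [Sil09] J. H. Silverman, *The Arithmetic of Elliptic Curves*, 2nd ed., GTM 106, Springer 2009, III §1 (the quantities
`b₂, b₄, b₆, b₈, c₄, c₆, Δ`), III.4.5, VII.5.1, App. C §15 (Tate's algorithm); [ST92] J. H. Silverman, J. Tate, *Rational Points on
Elliptic Curves*, UTM, Springer 1992, III §4 (the 2-isogeny `φ(x, y) = (y²/x², y(b − x²)/x²)` from `y² = x³ + ax² + bx` onto
`y² = x³ − 2ax² + (a² − 4b)x`). Cell records as above. Generator/pre-check: HOME/plean/g17/ (exact Python re-derivation of every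
number below before typing; the kernel re-checks all of them).
-/

namespace Summit.Ventures.AbcSig.L313QCurve

open Summit.Ventures.AbcSig

/-! ## The model over `ℤ[i]` -/

/-- The Gaussian unit `i = ⟨0, 1⟩`. -/
def gi : GaussianInt := ⟨0, 1⟩

/-- `π = 12 + 13i`, the prime of `ℤ[i]` above `313 = 12² + 13²` singled out by the model (`π̄ = star π = 12 − 13i`). -/
def piL : GaussianInt := ⟨12, 13⟩

/-- `a₂ = −132 + 132i`. -/
def a2 : GaussianInt := ⟨-132, 132⟩

/-- `a₄ = 3419 − 4356i`. -/
def a4 : GaussianInt := ⟨3419, -4356⟩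

/-- **The ℚ-curve of record behind `10016.1`**: `E : y² = x³ + (−132 + 132i)x² + (3419 − 4356i)x` over `ℤ[i]`
(`a₁ = a₃ = a₆ = 0`), as a Mathlib `WeierstrassCurve GaussianInt`. Identification grade (module docstring); nothing is
claimed about its modularity or conductor. -/
def E : WeierstrassCurve GaussianInt := ⟨0, a2, 0, a4, 0⟩

/-- The Galois-conjugate model `E^σ` (complex conjugation on the coefficients). -/
def Econj : WeierstrassCurve GaussianInt := ⟨0, star a2, 0, star a4, 0⟩

/-- `E^σ` is `E` mapped along the conjugation ring endomorphism `star` of `ℤ[i]` (Mathlib's `WeierstrassCurve.map`). -/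
theorem Econj_eq_map : Econj = E.map (starRingEnd GaussianInt) := by
  refine WeierstrassCurve.ext ?_ ?_ ?_ ?_ ?_ <;> simp [E, Econj, starRingEnd_apply]

/-! ## Invariants of the model (Mathlib's formulas, evaluated in the kernel) -/

/-- `N(π) = 12² + 13² = 313`. -/
theorem piL_norm : piL.norm = 313 := by decide

/-- `313` is a rational prime. -/
theorem prime_313 : Nat.Prime 313 := by norm_num

/-- A Gaussian integer whose norm is a rational prime is irreducible (norms are multiplicative and norm `1` means unit). -/
theorem irreducible_of_norm_prime {z : GaussianInt} (hz : Nat.Prime z.norm.natAbs) : Irreducible z := by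
  refine ⟨fun hu => ?_, fun a b hab => ?_⟩
  · rw [Zsqrtd.norm_eq_one_iff.2 hu] at hz
    exact Nat.not_prime_one hz
  · have h : z.norm.natAbs = a.norm.natAbs * b.norm.natAbs := by
      rw [hab, Zsqrtd.norm_mul, Int.natAbs_mul]
    rw [h] at hz
    rcases Nat.prime_mul_iff.1 hz with ⟨_, h1⟩ | ⟨_, h1⟩
    · exact Or.inr (Zsqrtd.norm_eq_one_iff.1 h1)
    · exact Or.inl (Zsqrtd.norm_eq_one_iff.1 h1)

/-- **`π = 12 + 13i` is a Gaussian prime** (`ℤ[i]` is Euclidean, so irreducible = prime). -/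
theorem piL_prime : Prime piL :=
  (irreducible_of_norm_prime (by rw [piL_norm]; exact prime_313)).prime

/-- So is `π̄ = 12 − 13i`. -/
theorem star_piL_prime : Prime (star piL) :=
  (irreducible_of_norm_prime (by rw [Zsqrtd.norm_conj, piL_norm]; exact prime_313)).prime

/-- `π̄` is not a unit multiple of `π` (the units of `ℤ[i]` are `±1, ±i`): the two primes above `313` are distinct. -/
theorem star_piL_ne : star piL ≠ piL ∧ star piL ≠ -piL ∧ star piL ≠ gi * piL ∧ star piL ≠ -(gi * piL) := by
  decide +kernel

/-- `a₄ = i·π̄³`. -/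
theorem a4_eq : a4 = gi * star piL ^ 3 := by decide +kernel

/-- `a₂² − 4a₄ = (1 + i)⁴·ā₄ = −4·ā₄` (the quantity `b` of the 2-isogenous model below; also `16·(a₂² − 4a₄)·a₄² = Δ`). -/
theorem a2_sq_sub : a2 ^ 2 - 4 * a4 = (1 + gi) ^ 4 * star a4 := by decide +kernel

/-- `c₄(E) = −164112 − 348480i` (Mathlib's `c₄ = b₂² − 24b₄`). -/
theorem E_c₄ : E.c₄ = ⟨-164112, -348480⟩ := by decide +kernel

/-- `c₆(E) = −258774912 + 1178496i` (Mathlib's `c₆`). -/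
theorem E_c₆ : E.c₆ = ⟨-258774912, 1178496⟩ := by decide +kernel

/-- `Δ(E) = −6709838812352 + 8548715374848i` (Mathlib's discriminant, LMFDB sign). -/
theorem E_Δ_val : E.Δ = ⟨-6709838812352, 8548715374848⟩ := by decide +kernel

/-- **`Δ(E) = i·(1 + i)¹²·π³·π̄⁶`** — the factorisation of record (engine-2 g31 / engine-1 g22: `Δ_min = i(1+i)¹²π³π̄⁶`). -/
theorem E_Δ : E.Δ = gi * (1 + gi) ^ 12 * piL ^ 3 * star piL ^ 6 := by
  rw [E_Δ_val]; decide +kernel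

/-- `(1 + i)¹² = −64`, so the factorisation reads `Δ = −64·i·π³·π̄⁶`. -/
theorem one_add_gi_pow_twelve : (1 + gi) ^ 12 = -64 := by decide +kernel

/-- **`N(Δ(E)) = 2¹²·313⁹`** (the number both hands print as `N(Δ_min)`). -/
theorem E_Δ_norm : E.Δ.norm = 2 ^ 12 * 313 ^ 9 := by
  rw [E_Δ_val]; decide +kernel

/-- `N(c₄(E)) = 148371058944 = 2¹⁴·3²·… ` is coprime to `313`: neither prime above `313` divides `c₄`. -/
theorem E_c₄_norm_coprime : Int.gcd (E.c₄).norm 313 = 1 := by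
  rw [E_c₄]; decide +kernel

/-! ## Local data at `π` and `π̄` through explicit reduction maps `ℤ[i] → 𝔽₃₁₃` -/

/-- `288² = −1` in `𝔽₃₁₃`. -/
theorem sq_288 : (288 : ZMod 313) * 288 = ((-1 : ℤ) : ZMod 313) := by decide

/-- `25² = −1` in `𝔽₃₁₃`. -/
theorem sq_25 : (25 : ZMod 313) * 25 = ((-1 : ℤ) : ZMod 313) := by decide

/-- The reduction map `ℤ[i] → 𝔽₃₁₃`, `i ↦ 288` (Mathlib's `Zsqrtd.lift`); it kills `π = 12 + 13i` (`12 + 13·288 = 12·313`), so —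
`(π)` being maximal — it is reduction modulo `π`. -/
def redPi : GaussianInt →+* ZMod 313 := Zsqrtd.lift ⟨288, sq_288⟩

/-- The reduction map `ℤ[i] → 𝔽₃₁₃`, `i ↦ 25 = −288`; it kills `π̄ = 12 − 13i`: reduction modulo `π̄`. -/
def redPiBar : GaussianInt →+* ZMod 313 := Zsqrtd.lift ⟨25, sq_25⟩

/-- `redPi z = z.re + 288·z.im`. -/
theorem redPi_apply (z : GaussianInt) : redPi z = (z.re : ZMod 313) + (z.im : ZMod 313) * 288 := rfl

/-- `redPiBar z = z.re + 25·z.im`. -/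
theorem redPiBar_apply (z : GaussianInt) : redPiBar z = (z.re : ZMod 313) + (z.im : ZMod 313) * 25 := rfl

/-- `redPi` kills `π` and not `π̄`; `redPiBar` kills `π̄` and not `π`. -/
theorem red_piL : redPi piL = 0 ∧ redPi (star piL) = 24 ∧ redPiBar (star piL) = 0 ∧ redPiBar piL = 24 := by
  refine ⟨?_, ?_, ?_, ?_⟩ <;> decide +kernel

/-- `π ∤ c₄(E)` and `π̄ ∤ c₄(E)` (`c₄ ↦ 171` resp. `255` in `𝔽₃₁₃`): with `π, π̄ ∣ Δ` this is MULTIPLICATIVE reduction at both primes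
above `313`, and the model is minimal there ([Sil09, VII.5.1 (b), Rem. VII.1.1]; standard theory, not re-proved). -/
theorem red_c₄ : redPi E.c₄ = 171 ∧ redPiBar E.c₄ = 255 ∧ (171 : ZMod 313) ≠ 0 ∧ (255 : ZMod 313) ≠ 0 := by
  rw [E_c₄]; refine ⟨?_, ?_, ?_, ?_⟩ <;> decide +kernel

/-- **`v_π(Δ) = 3`**: `Δ = π³·D₁` with `D₁ = i(1+i)¹²π̄⁶ ↦ 114 ≠ 0` modulo `π` (Kodaira type `I₃` at `π` by [Sil09, C.15]). -/
theorem E_Δ_at_piL : E.Δ = piL ^ 3 * (gi * (1 + gi) ^ 12 * star piL ^ 6) ∧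
    redPi (gi * (1 + gi) ^ 12 * star piL ^ 6) = 114 ∧ (114 : ZMod 313) ≠ 0 := by
  rw [E_Δ_val]; refine ⟨?_, ?_, ?_⟩ <;> decide +kernel

/-- **`v_π̄(Δ) = 6`**: `Δ = π̄⁶·D₂` with `D₂ = i(1+i)¹²π³ ↦ 58 ≠ 0` modulo `π̄` (Kodaira type `I₆` at `π̄`). -/
theorem E_Δ_at_star_piL : E.Δ = star piL ^ 6 * (gi * (1 + gi) ^ 12 * piL ^ 3) ∧
    redPiBar (gi * (1 + gi) ^ 12 * piL ^ 3) = 58 ∧ (58 : ZMod 313) ≠ 0 := by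
  rw [E_Δ_val]; refine ⟨?_, ?_, ?_⟩ <;> decide +kernel

/-- `E mod π` is `y² = x³ + 11x² + 265x` over `𝔽₃₁₃`. -/
theorem E_mod_piL : E.map redPi = ⟨0, 11, 0, 265, 0⟩ := by
  refine WeierstrassCurve.ext ?_ ?_ ?_ ?_ ?_ <;> simp only [E, WeierstrassCurve.map, map_zero] <;> decide +kernel

/-- `E mod π̄` is `y² = x³ + 38x²` over `𝔽₃₁₃` (`a₄ = iπ̄³ ↦ 0`). -/
theorem E_mod_star_piL : E.map redPiBar = ⟨0, 38, 0, 0, 0⟩ := by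
  refine WeierstrassCurve.ext ?_ ?_ ?_ ?_ ?_ <;> simp only [E, WeierstrassCurve.map, map_zero] <;> decide +kernel

/-- At `π` the reduced cubic is `x(x − 151)²` (node at `(151, 0)`) and the tangent slopes there are `±√151 = ±82 ∈ 𝔽₃₁₃`:
SPLIT multiplicative reduction at `π` ([Sil09, VII.5.1 (b)] / Tate's algorithm step for `b₂` a square; read, not re-proved). -/
theorem split_at_piL : (∀ x : ZMod 313, x ^ 3 + 11 * x ^ 2 + 265 * x = x * (x - 151) ^ 2) ∧
    (82 : ZMod 313) ^ 2 = 151 ∧ (151 : ZMod 313) ≠ 0 := by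
  refine ⟨fun x => ?_, by decide, by decide⟩
  have h1 : (11 : ZMod 313) = -(2 * 151) := by decide
  have h2 : (265 : ZMod 313) = 151 ^ 2 := by decide
  rw [h1, h2]; ring

/-- At `π̄` the reduced cubic is `x²(x + 38)` (node at `(0, 0)`) and the tangent slopes are `±√38 = ±59 ∈ 𝔽₃₁₃`: SPLIT multiplicative
reduction at `π̄`. -/
theorem split_at_star_piL : (∀ x : ZMod 313, x ^ 3 + 38 * x ^ 2 = x ^ 2 * (x + 38)) ∧
    (59 : ZMod 313) ^ 2 = 38 ∧ (38 : ZMod 313) ≠ 0 :=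
  ⟨fun x => by ring, by decide, by decide⟩

/-! ## The 2-isogeny codomain is the rescaled conjugate: the ℚ-curve identity at coefficient level -/

/-- The PRINTED codomain of the 2-isogeny with kernel `⟨(0, 0)⟩` on `y² = x³ + a·x² + b·x` (`b(a² − 4b) ≠ 0`):
`y² = x³ − 2a·x² + (a² − 4b)·x`, `φ(x, y) = (y²/x², y(b − x²)/x²)` [ST92, III §4; Sil09, III.4.5]. CITED normal form; the isogeny is
not constructed in this file. -/
def twoIsogenyCodomain {R : Type*} [CommRing R] (a b : R) : WeierstrassCurve R := ⟨0, -2 * a, 0, a ^ 2 - 4 * b, 0⟩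

/-- Integral rescaling of a Weierstrass model by `u`: `aᵢ ↦ uⁱ·aᵢ` — the model obtained by the substitution
`(x, y) = (x′/u², y′/u³)`; wherever `u` is invertible it is Mathlib's variable change with unit `u⁻¹` (`intScale_eq_smul`). -/
def intScale {R : Type*} [CommRing R] (u : R) (W : WeierstrassCurve R) : WeierstrassCurve R :=
  ⟨u * W.a₁, u ^ 2 * W.a₂, u ^ 3 * W.a₃, u ^ 4 * W.a₄, u ^ 6 * W.a₆⟩

/-- `intScale u` is the admissible change of variables `⟨u⁻¹, 0, 0, 0⟩` of Mathlib whenever `u` is a unit. -/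
theorem intScale_eq_smul {R : Type*} [CommRing R] (u : Rˣ) (W : WeierstrassCurve R) :
    intScale (u : R) W = (⟨u⁻¹, 0, 0, 0⟩ : WeierstrassCurve.VariableChange R) • W := by
  ext <;> simp [intScale, WeierstrassCurve.variableChange_def]

/-- `intScale` commutes with base change along a ring map. -/
theorem intScale_map {R S : Type*} [CommRing R] [CommRing S] (f : R →+* S) (u : R) (W : WeierstrassCurve R) :
    (intScale u W).map f = intScale (f u) (W.map f) := by
  ext <;> simp [intScale, WeierstrassCurve.map]

/-- `twoIsogenyCodomain` commutes with base change along a ring map. -/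
theorem twoIsogenyCodomain_map {R S : Type*} [CommRing R] [CommRing S] (f : R →+* S) (a b : R) :
    (twoIsogenyCodomain a b).map f = twoIsogenyCodomain (f a) (f b) := by
  ext <;> simp [twoIsogenyCodomain, WeierstrassCurve.map, map_ofNat]

/-- **The ℚ-curve identity (bare coefficient equality).** The PRINTED 2-isogeny codomain of `E` ([ST92, III §4] / Vélu; cited in
`twoIsogenyCodomain`, not constructed), `y² = x³ + (264 − 264i)x² + (−13676 − 17424i)x`, is «the `(1 + i)`-scaling of `E^σ`»:
`(a₂′, a₄′) = (−2a₂, a₂² − 4a₄) = ((1+i)²·σ(a₂), (1+i)⁴·σ(a₄))` (and `a₁′ = a₃′ = a₆′ = 0`), `σ` = complex conjugation. The scaling map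
itself is `intScale` (substitution `(x, y) = (x′/u², y′/u³)`, `u = 1 + i`), an isomorphism of Weierstrass models only where `1 + i` is
invertible (`isogenyCodomain_map_eq_smul_conj`). -/
theorem isogenyCodomain_eq_intScale_conj : twoIsogenyCodomain a2 a4 = intScale (1 + gi) Econj := by
  refine WeierstrassCurve.ext ?_ ?_ ?_ ?_ ?_ <;> decide +kernel

/-- The same with the numbers spelled out. -/
theorem isogenyCodomain_val : twoIsogenyCodomain a2 a4 = ⟨0, ⟨264, -264⟩, 0, ⟨-13676, -17424⟩, 0⟩ := by
  refine WeierstrassCurve.ext ?_ ?_ ?_ ?_ ?_ <;> decide +kernel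

/-- **Consequence in Mathlib's vocabulary.** Over any commutative ring `K` receiving `ℤ[i]` in which `1 + i` becomes a unit `u`
(e.g. `K = ℚ(i)`, or any field of characteristic `≠ 2` with a square root of `−1`), the printed 2-isogeny codomain of `E` and the
conjugate curve `E^σ` are related by Mathlib's admissible change of variables `⟨u⁻¹, 0, 0, 0⟩`, `(x, y) ↦ (u²x, u³y)` — THIS is the
scaling map, and with it (and only over such `K`) the two are `K`-isomorphic Weierstrass models. Combined with the CITED isogeny (not
constructed here) this is the content of "`E` is 2-isogenous over `ℚ(i)` to its Galois conjugate" (ℚ-curve of degree 2); the file proves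
the coefficient identity and the change of variables, nothing about isogenies. -/
theorem isogenyCodomain_map_eq_smul_conj {K : Type*} [CommRing K] (f : GaussianInt →+* K) (u : Kˣ) (hu : (u : K) = f (1 + gi)) :
    (twoIsogenyCodomain a2 a4).map f = (⟨u⁻¹, 0, 0, 0⟩ : WeierstrassCurve.VariableChange K) • Econj.map f := by
  rw [isogenyCodomain_eq_intScale_conj, intScale_map, ← hu, intScale_eq_smul]

/-! ## Kernel point counts over `𝔽₄₉` and `𝔽₅₂₉` and the tie to `Levels/N10016.lean` -/

/-- Multiplication of `𝔽_q[i]` on canonical integer pairs `(u, v) ↔ u + v·i` reduced modulo `q` (this is the field `𝔽_{q²}` exactly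
when `q` is a prime `≡ 3 (mod 4)`, i.e. inert in `ℤ[i]`). -/
def fqiMul (q : ℕ) (x y : ℤ × ℤ) : ℤ × ℤ :=
  ((x.1 * y.1 - x.2 * y.2) % (q : ℤ), (x.1 * y.2 + x.2 * y.1) % (q : ℤ))

/-- Addition of `𝔽_q[i]` on canonical pairs. -/
def fqiAdd (q : ℕ) (x y : ℤ × ℤ) : ℤ × ℤ := ((x.1 + y.1) % (q : ℤ), (x.2 + y.2) % (q : ℤ))

/-- Reduction of a Gaussian integer to its canonical pair modulo `q`. -/
def fqiOf (q : ℕ) (z : GaussianInt) : ℤ × ℤ := (z.re % (q : ℤ), z.im % (q : ℤ))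

/-- The `q²` elements of `𝔽_q[i]` as canonical pairs. -/
def fqiElems (q : ℕ) : List (ℤ × ℤ) :=
  (List.range q).flatMap fun u => (List.range q).map fun v => ((u : ℤ), (v : ℤ))

/-- `x³ + a₂x² + a₄x` in `𝔽_q[i]` for the model `E`. -/
def rhsMod (q : ℕ) (x : ℤ × ℤ) : ℤ × ℤ :=
  fqiAdd q (fqiAdd q (fqiMul q (fqiMul q x x) x) (fqiMul q (fqiOf q a2) (fqiMul q x x))) (fqiMul q (fqiOf q a4) x)

/-- Number of points of `E` over `𝔽_q[i]` given the list of all squares `y²` (with multiplicity): the affine solutions `(x, y)` of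
`y² = x³ + a₂x² + a₄x`, counted by plain double enumeration, plus the point at infinity. -/
def pointCountWith (q : ℕ) (squares : List (ℤ × ℤ)) : ℕ :=
  (((fqiElems q).map fun x => squares.countP fun s => decide (s = rhsMod q x)).sum) + 1

/-- **`#E(𝔽_q[i])`** by transparent enumeration (meaningful as `#E(𝔽_{q²})` for primes `q ≡ 3 (mod 4)` of good reduction). -/
def pointCount (q : ℕ) : ℕ := pointCountWith q ((fqiElems q).map fun y => fqiMul q y y)

/-- **`#E(𝔽₄₉) = 46`** (`7` is inert in `ℤ[i]`; kernel enumeration of `49²` pairs). -/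
theorem pointCount_7 : pointCount 7 = 46 := by decide +kernel

/-- **`#E(𝔽₅₂₉) = 558`** (`23` is inert in `ℤ[i]`; kernel enumeration). -/
theorem pointCount_23 : pointCount 23 = 558 := by decide +kernel

/-- The level file of record lists, for orbit `10016.1`, the characteristic polynomials `P₇ = P₂₃ = t² − 18` (`c₇² = c₂₃² = 18`,
`c_q ∈ √2·ℤ` at `q ≡ 3 (mod 4)` by the inner twist). Definitional re-statement of `cp_10016_1` (`Levels/N10016.lean`). -/
theorem cp_10016_1_eq : cp_10016_1 = [⟨7, [-18, 0, 1]⟩, ⟨23, [-18, 0, 1]⟩] := rfl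

/-- **Tie at `q = 7`.** `#E(𝔽₄₉)` (the transparent counter `pointCount`) `= (q + 1)² − c_q²` at `q = 7` with `c_q² = 18` read from
`Levels/N10016.lean`'s `cp_10016_1` — the value the identification predicts at an inert prime (`a_{(q)}(E) = c_q² − 2q`). A CONSISTENCY
identity with the level file, not a modularity statement and not a proof of the hypothesis of record. -/
theorem tie_7 : (pointCount 7 : ℤ) = (7 + 1) ^ 2 - 18 := by
  rw [pointCount_7]; norm_num

/-- **Tie at `q = 23`** (the residue characteristic of the open instance): `pointCount 23 = (23 + 1)² − 18 = 558` with `c₂₃² = 18` read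
from `cp_10016_1` — a CONSISTENCY identity with the level file, not a modularity statement. -/
theorem tie_23 : (pointCount 23 : ℤ) = (23 + 1) ^ 2 - 18 := by
  rw [pointCount_23]; norm_num

end Summit.Ventures.AbcSig.L313QCurve
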